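import Literature.Analysis.FluidPDE.TaoAveragedJointWeightData
import Literature.Analysis.FluidPDE.TaoAveragedIsoscelesDegeneracy
import HarnessLib

/-!
# Tao 2016, §3.2 (3.7) / §3.9 (3.24) for a GENERAL base triangle: frame triples, the reduction of
# every closed base triangle to a frame triple, and the non-degeneracy (3.24) near a base triangle
# with distinct input moduli

T. Tao, *Finite time blowup for an averaged three-dimensional Navier–Stokes equation*,
J. Amer. Math. Soc. **29** (2016), 601–674 = arXiv:1402.0290v3, §3.2 p. 15 ("we have the freedom
to rotate … each of the `ξⱼ⁰` as we please"), §3.7 (3.18) (`Γ ⊆ Πⱼ B(ξⱼ⁰, Cε₀³)`), §3.9 (3.24) and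
Remark 3.5 p. 20 ("This condition in fact holds for generic `ξ⁰₁, ξ⁰₂, ξ⁰₃`"). HONEST FRAMING (cell
harvest/h2-tao-ladder, TAO-LADDER rung `M_1` — MODEL statements about Tao's averaged equation):
groundwork for the rung-1 crux `SingleScaleNoDilAt` (the tree's §3.6–3.9,
`TaoAveragedJointWeightData/Proofs`, re-run with the base triple as a parameter). Nothing here
concerns the true Navier–Stokes equations.

* `IsFrameTriple ξ` — a closed base triple **in frame position**: in the horizontal plane, third
  vector along `e₀ = (1,0,0)` (the tree's `ksE0`), positively oriented (`ξ 0` has positive second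
  coordinate), side lengths in the crux window `[4/5, 3/2]`. Tao's (3.7) `xi0` is a frame triple
  (`isFrameTriple_xi0`). In frame position the reference frame `(ksE0, northVec)` of the tree's
  rotation disintegration is kept: `udir (ξ 2) = ksE0`, `gammaNormal ξ = northVec`
  (`IsFrameTriple.udir_two`, `IsFrameTriple.gammaNormal_eq`), and `ξ 0 = (α, h, 0)` with
  `c α = (b²-a²-c²)/2`, `c h = |ξ 2 × ξ 0|`, `h ≥ 1/25` (`IsFrameTriple.two_zero_mul_zero_zero`,
  `IsFrameTriple.norm_cross_two_zero`, `IsFrameTriple.zero_one_ge`);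
* `norm_cross_sq_of_sum_eq_zero`, `norm_cross_ge_of_window` — `4|η₀ × η₁|² = (a+b+c)(a+b-c)(a-b+c)(b-a+c)`
  for a closed triangle, hence `|η₀ × η₁| ≥ 1/16` when the sides lie in `[79/100, 151/100]`;
* `exists_isometry_frameTriple` — **every closed triple with sides in `[4/5, 3/2]` is `S ∘ ζ` for a
  linear isometry `S` and a frame triple `ζ`** (orthonormal frame `(ξ₂/|ξ₂|, n × ξ₂/|ξ₂|, n)`,
  `n = gammaNormal ξ`);
* `NondegWithin ξ δ` — the conclusions of the tree's `lambdaSigma_ne_zero_near_xi0` for all closed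
  `η` with `|ηⱼ - ξⱼ| < δ`; `nondegWithin_of_window_gap` — **(3.24) near any base triangle with sides in
  `[4/5, 3/2]` and distinct input moduli**: it holds whenever `δ ≤ 1/100` and `2δ < |‖ξ 0‖ - ‖ξ 1‖|`
  (`cSigma_ne_zero_of_triangle` of `TaoAveragedIsoscelesDegeneracy.lean` at each `η`; no implicit
  function theorem and no Lipschitz estimate are needed — the radius is linear in the input gap).

## References

* T. Tao, J. Amer. Math. Soc. 29 (2016), 601–674, arXiv:1402.0290v3, §3.2 (3.7) p. 15, §3.7 (3.18)
  p. 19, §3.9 (3.24) p. 20, Remark 3.5 p. 20. Key `Tao2016AveragedNS`.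
-/

noncomputable section

open Real MeasureTheory Module
open scoped RealInnerProductSpace

namespace Literature.Analysis.FluidPDE.Tao2016

/-- Local notation for physical / frequency space `ℝ³`. -/
local notation "ℝ³" => EuclideanSpace ℝ (Fin 3)

/-! ### Elementary identities in `ℝ³` -/

/-- `‖x‖² = x₀² + x₁² + x₂²`. [folklore] -/
private theorem norm_sq_fin3 (x : ℝ³) : ‖x‖ ^ 2 = x 0 * x 0 + x 1 * x 1 + x 2 * x 2 := by
  rw [← real_inner_self_eq_norm_sq, real_inner_fin3]

/-- `e₀ × (0,0,1) = (0,-1,0)`. [folklore] -/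
private theorem cross_ksE0_northVec_eq : cross ksE0 northVec = !₂[0, -1, 0] := by
  ext i
  fin_cases i <;> simp [cross_apply_zero, cross_apply_one, cross_apply_two, ksE0, northVec]

/-- The scalar triple product is alternating: `⟪n × y, x⟫ = -⟪n, x × y⟫`. [folklore] -/
private theorem inner_cross_left_eq_neg (n x y : ℝ³) : ⟪cross n y, x⟫ = -⟪n, cross x y⟫ := by
  simp only [real_inner_fin3, cross_apply_zero, cross_apply_one, cross_apply_two]
  ring

/-- `⟪u/|u|, u⟫ = |u|`. [folklore] -/
private theorem inner_udir_self (u : ℝ³) : ⟪udir u, u⟫ = ‖u‖ := by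
  rw [udir, real_inner_smul_left, real_inner_self_eq_norm_sq]
  by_cases h : u = 0
  · rw [h, norm_zero]; ring
  · field_simp [norm_ne_zero_iff.mpr h]

/-- For a closed triangle, `ξ₀ × ξ₁ = ξ₂ × ξ₀`. [folklore] -/
private theorem cross_zero_one_eq_cross_two_zero {ξ : Fin 3 → ℝ³} (hsum : ξ 0 + ξ 1 + ξ 2 = 0) :
    cross (ξ 0) (ξ 1) = cross (ξ 2) (ξ 0) := by
  have h1 : ξ 1 = -ξ 0 - ξ 2 := by
    have : ξ 1 = (ξ 0 + ξ 1 + ξ 2) - ξ 0 - ξ 2 := by abel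
    rw [this, hsum]; abel
  rw [h1]
  ext i
  fin_cases i <;> simp [cross_apply_zero, cross_apply_one, cross_apply_two] <;> ring

/-! ### The area of a closed triangle from its side lengths -/

/-- **Heron in vector form**: for a closed triangle `η₀ + η₁ + η₂ = 0` with side lengths `a, b, c`,
`4 |η₀ × η₁|² = (a+b+c)(a+b-c)(a-b+c)(b-a+c)` (Lagrange's identity and the law of cosines). [cite: Tao2016AveragedNS, §3.2 p. 15 and §3.9 (3.24) p. 20] -/
theorem norm_cross_sq_of_sum_eq_zero (η : Fin 3 → ℝ³) (hsum : η 0 + η 1 + η 2 = 0) :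
    4 * ‖cross (η 0) (η 1)‖ ^ 2 =
      (‖η 0‖ + ‖η 1‖ + ‖η 2‖) * (‖η 0‖ + ‖η 1‖ - ‖η 2‖) * (‖η 0‖ - ‖η 1‖ + ‖η 2‖) *
        (‖η 1‖ - ‖η 0‖ + ‖η 2‖) := by
  have hlag := norm_cross_sq (η 0) (η 1)
  have hs : η 2 + η 0 + η 1 = 0 := by rw [← hsum]; abel
  have h01 : ⟪η 0, η 1⟫ = (‖η 2‖ ^ 2 - ‖η 0‖ ^ 2 - ‖η 1‖ ^ 2) / 2 := inner_of_sum_eq_zero _ _ _ hs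
  rw [hlag, h01]
  ring

/-- **Non-collinearity in the (slightly widened) crux window**: a closed triangle with all sides in
`[79/100, 151/100]` has `|η₀ × η₁| ≥ 1/16` (the three triangle slacks are `≥ 7/100`, two of them sum
to twice a side). [cite: Tao2016AveragedNS, §3.2 p. 15 and §3.8 p. 19] -/
theorem norm_cross_ge_of_window (η : Fin 3 → ℝ³) (hsum : η 0 + η 1 + η 2 = 0)
    (hwin : ∀ j, 79 / 100 ≤ ‖η j‖ ∧ ‖η j‖ ≤ 151 / 100) : 1 / 16 ≤ ‖cross (η 0) (η 1)‖ := by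
  have h := norm_cross_sq_of_sum_eq_zero η hsum
  obtain ⟨a1, a2⟩ := hwin 0
  obtain ⟨b1, b2⟩ := hwin 1
  obtain ⟨c1, c2⟩ := hwin 2
  set a := ‖η 0‖
  set b := ‖η 1‖
  set c := ‖η 2‖
  set x := a + b - c with hx
  set y := a - b + c with hy
  set z := b - a + c with hz
  have hx0 : 7 / 100 ≤ x := by rw [hx]; linarith
  have hy0 : 7 / 100 ≤ y := by rw [hy]; linarith
  have hz0 : 7 / 100 ≤ z := by rw [hz]; linarith
  have hyz : 1 / 10 ≤ y * z := by
    have hsum' : 158 / 100 ≤ y + z := by rw [hy, hz]; linarith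
    nlinarith [mul_nonneg (by linarith : 0 ≤ y - 7 / 100) (by linarith : 0 ≤ z - 7 / 100)]
  have hxyz : 7 / 1000 ≤ x * (y * z) := by nlinarith
  have habc : 237 / 100 ≤ a + b + c := by linarith
  have hsq : (1 / 16 : ℝ) ^ 2 ≤ ‖cross (η 0) (η 1)‖ ^ 2 := by
    have : 4 * ‖cross (η 0) (η 1)‖ ^ 2 = (a + b + c) * (x * (y * z)) := by rw [h]; ring
    nlinarith
  exact (pow_le_pow_iff_left₀ (by norm_num) (norm_nonneg _) two_ne_zero).1 hsq

/-! ### Frame triples -/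

/-- **A closed base triple in frame position** (the generalisation of Tao's normalisation (3.7) that
keeps the reference frame `(e₀, (0,0,1))` of the rotation disintegration): the three vectors lie in
the horizontal plane and close up, `ξ 2 = (c, 0, 0)` points along `e₀` (`c > 0`), `ξ 0 = (α, h, 0)`
has `h > 0` (positive orientation: the unit normal `(ξ 0 × ξ 1)/|ξ 0 × ξ 1|` is `(0,0,1)`), and the
side lengths lie in the window `[4/5, 3/2]` of the rung-1 crux. Without dilation averaging only a
common ROTATION of the base triple is available (Remark 3.5), so the side lengths are free
parameters. [cite: Tao2016AveragedNS, §3.2 (3.7) p. 15 and Remark 3.5 p. 20] -/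
structure IsFrameTriple (ξ : Fin 3 → ℝ³) : Prop where
  /-- the triangle closes: `ξ 0 + ξ 1 + ξ 2 = 0` -/
  sum : ξ 0 + ξ 1 + ξ 2 = 0
  /-- the triangle lies in the horizontal plane -/
  planar : ∀ j, ξ j 2 = 0
  /-- `ξ 2` lies on the first axis … -/
  two_one : ξ 2 1 = 0
  /-- … on its positive side -/
  two_zero : 0 < ξ 2 0
  /-- positive orientation: `ξ 0` lies in the upper half-plane -/
  zero_one : 0 < ξ 0 1
  /-- the side lengths lie in the crux window -/
  window : ∀ j, 4 / 5 ≤ ‖ξ j‖ ∧ ‖ξ j‖ ≤ 3 / 2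

/-- **Tao's normalisation (3.7) is a frame triple** (sides `1, √2, 1`). [cite: Tao2016AveragedNS, §3.2 (3.7) p. 15] -/
theorem isFrameTriple_xi0 : IsFrameTriple xi0 := by
  have hs : (1 : ℝ) ≤ Real.sqrt 2 ∧ Real.sqrt 2 ≤ 3 / 2 := by
    constructor
    · exact Real.one_le_sqrt.mpr (by norm_num)
    · rw [show (3 / 2 : ℝ) = Real.sqrt ((3 / 2) ^ 2) by rw [Real.sqrt_sq (by norm_num)]]
      exact Real.sqrt_le_sqrt (by norm_num)
  refine ⟨xi0_sum, fun j => ?_, by simp [xi0], by simp [xi0], by simp [xi0], fun j => ?_⟩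
  · fin_cases j <;> simp [xi0]
  · match j with
    | 0 => rw [norm_xi0_zero]; norm_num
    | 1 => rw [norm_xi0_one]; exact ⟨by linarith [hs.1], hs.2⟩
    | 2 => rw [norm_xi0_two]; norm_num

namespace IsFrameTriple

variable {ξ : Fin 3 → ℝ³} (hξ : IsFrameTriple ξ)
include hξ

/-- All three vectors are non-zero. [cite: Tao2016AveragedNS, §3.2 (3.7) p. 15] -/
theorem ne_zero (j : Fin 3) : ξ j ≠ 0 := by
  intro h
  have := (hξ.window j).1
  rw [h, norm_zero] at this
  linarith

/-- `‖ξ 2‖ = c`, the first coordinate of `ξ 2`. [cite: Tao2016AveragedNS, §3.2 (3.7) p. 15] -/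
theorem norm_two : ‖ξ 2‖ = ξ 2 0 := by
  have h := norm_sq_fin3 (ξ 2)
  rw [hξ.two_one, hξ.planar 2] at h
  have h' : ‖ξ 2‖ ^ 2 = (ξ 2 0) ^ 2 := by rw [h]; ring
  exact (pow_left_inj₀ (norm_nonneg _) hξ.two_zero.le two_ne_zero).1 h'

/-- `ξ 2 = |ξ 2| e₀`. [cite: Tao2016AveragedNS, §3.2 (3.7) p. 15] -/
theorem two_eq : ξ 2 = ‖ξ 2‖ • ksE0 := by
  ext i
  fin_cases i
  · simp [ksE0, hξ.norm_two]
  · simp [ksE0, hξ.two_one]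
  · simp [ksE0, hξ.planar 2]

/-- `ξ 2 / |ξ 2| = e₀`. [cite: Tao2016AveragedNS, §3.2 (3.7) p. 15] -/
theorem udir_two : udir (ξ 2) = ksE0 := by
  have h0 : ξ 2 0 ≠ 0 := hξ.two_zero.ne'
  ext i
  fin_cases i <;> simp [udir, ksE0, hξ.norm_two, hξ.two_one, hξ.planar 2, h0]

/-- `ξ 0 = α e₀ - h (e₀ × (0,0,1))` with `α = ξ 0 0`, `h = ξ 0 1` (note `e₀ × (0,0,1) = (0,-1,0)`). [cite: Tao2016AveragedNS, §3.2 (3.7) p. 15] -/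
theorem zero_eq : ξ 0 = (ξ 0 0) • ksE0 - (ξ 0 1) • cross ksE0 northVec := by
  rw [cross_ksE0_northVec_eq]
  ext i
  fin_cases i
  · simp [ksE0]
  · simp [ksE0]
  · simp [ksE0, hξ.planar 0]

/-- `ξ 2 × ξ 0 = (c h) (0,0,1)`. [cite: Tao2016AveragedNS, §3.2 (3.7) p. 15] -/
theorem cross_two_zero : cross (ξ 2) (ξ 0) = (ξ 2 0 * ξ 0 1) • northVec := by
  ext i
  fin_cases i <;>
    simp [cross_apply_zero, cross_apply_one, cross_apply_two, northVec, hξ.two_one, hξ.planar 0, hξ.planar 2]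

/-- `|ξ 2 × ξ 0| = c h`. [cite: Tao2016AveragedNS, §3.2 (3.7) p. 15] -/
theorem norm_cross_two_zero : ‖cross (ξ 2) (ξ 0)‖ = ‖ξ 2‖ * ξ 0 1 := by
  rw [hξ.cross_two_zero, norm_smul, norm_northVec, mul_one, Real.norm_eq_abs,
    abs_of_pos (mul_pos hξ.two_zero hξ.zero_one), hξ.norm_two]

/-- `ξ 0 × ξ 1 = (c h) (0,0,1)` as well (the triangle closes). [cite: Tao2016AveragedNS, §3.2 (3.7) p. 15] -/
theorem cross_zero_one : cross (ξ 0) (ξ 1) = (ξ 2 0 * ξ 0 1) • northVec := by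
  rw [cross_zero_one_eq_cross_two_zero hξ.sum, hξ.cross_two_zero]

/-- `ξ 0 × ξ 1 ≠ 0`: a frame triple is non-collinear. [cite: Tao2016AveragedNS, §3.2 (3.7) p. 15] -/
theorem cross_zero_one_ne_zero : cross (ξ 0) (ξ 1) ≠ 0 := by
  rw [hξ.cross_zero_one]
  intro h
  rw [smul_eq_zero] at h
  rcases h with h | h
  · exact (mul_pos hξ.two_zero hξ.zero_one).ne' h
  · have := norm_northVec; rw [h, norm_zero] at this; exact zero_ne_one this

/-- **The unit normal of a frame triple is `(0,0,1)`** (so the normal cut-off of the tree's joint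
weight is centred correctly). [cite: Tao2016AveragedNS, §3.8 p. 19] -/
theorem gammaNormal_eq : gammaNormal ξ = northVec := by
  have hpos : 0 < ξ 2 0 * ξ 0 1 := mul_pos hξ.two_zero hξ.zero_one
  rw [gammaNormal, hξ.cross_zero_one, udir, norm_smul, norm_northVec, mul_one, Real.norm_eq_abs,
    abs_of_pos hpos, smul_smul, inv_mul_cancel₀ hpos.ne', one_smul]

/-- `(0,0,1) ⊥ ξ j`. [cite: Tao2016AveragedNS, §3.2 (3.7) p. 15] -/
theorem inner_northVec (j : Fin 3) : ⟪northVec, ξ j⟫ = 0 := by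
  simp [real_inner_fin3, northVec, hξ.planar j]

/-- The law of cosines in frame position: `c α = ⟪ξ 0, ξ 2⟫ = (b² - a² - c²)/2`. [cite: Tao2016AveragedNS, §3.2 (3.7) p. 15] -/
theorem two_zero_mul_zero_zero :
    ξ 2 0 * ξ 0 0 = (‖ξ 1‖ ^ 2 - ‖ξ 0‖ ^ 2 - ‖ξ 2‖ ^ 2) / 2 := by
  have hs : ξ 1 + ξ 0 + ξ 2 = 0 := by rw [← hξ.sum]; abel
  have h := inner_of_sum_eq_zero _ _ _ hs
  rw [real_inner_fin3, hξ.two_one, hξ.planar 2] at h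
  linarith

omit hξ in
/-- `⟪ξ 0, e₀⟫ = α`. [cite: Tao2016AveragedNS, §3.2 (3.7) p. 15] -/
theorem inner_zero_ksE0 : ⟪ξ 0, ksE0⟫ = ξ 0 0 := by
  simp [real_inner_fin3, ksE0]

omit hξ in
/-- `⟪ξ 0, e₀ × (0,0,1)⟫ = -h`. [cite: Tao2016AveragedNS, §3.2 (3.7) p. 15] -/
theorem inner_zero_cross_ksE0_northVec : ⟪ξ 0, cross ksE0 northVec⟫ = -(ξ 0 1) := by
  rw [cross_ksE0_northVec_eq]
  simp [real_inner_fin3]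

/-- `α² + h² = a²`. [cite: Tao2016AveragedNS, §3.2 (3.7) p. 15] -/
theorem sq_add_sq : ξ 0 0 ^ 2 + ξ 0 1 ^ 2 = ‖ξ 0‖ ^ 2 := by
  rw [norm_sq_fin3, hξ.planar 0]; ring

/-- `|α| ≤ a ≤ 3/2`. [cite: Tao2016AveragedNS, §3.2 (3.7) p. 15] -/
theorem abs_zero_zero_le : |ξ 0 0| ≤ 3 / 2 := by
  have h := hξ.sq_add_sq
  have ha := (hξ.window 0).2
  have h1 : ξ 0 0 ^ 2 ≤ (3 / 2) ^ 2 := by nlinarith [sq_nonneg (ξ 0 1), norm_nonneg (ξ 0)]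
  exact abs_le_of_sq_le_sq' h1 (by norm_num) |> fun h => abs_le.mpr h

/-- **The height is bounded below**: `h ≥ 1/25` (`c h = |ξ 0 × ξ 1| ≥ 1/16`, `c ≤ 3/2`). [cite: Tao2016AveragedNS, §3.2 (3.7) p. 15] -/
theorem zero_one_ge : 1 / 25 ≤ ξ 0 1 := by
  have hwin' : ∀ j, 79 / 100 ≤ ‖ξ j‖ ∧ ‖ξ j‖ ≤ 151 / 100 := fun j =>
    ⟨by linarith [(hξ.window j).1], by linarith [(hξ.window j).2]⟩
  have h := norm_cross_ge_of_window ξ hξ.sum hwin'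
  rw [hξ.cross_zero_one, norm_smul, norm_northVec, mul_one, Real.norm_eq_abs,
    abs_of_pos (mul_pos hξ.two_zero hξ.zero_one)] at h
  have hc : ξ 2 0 ≤ 3 / 2 := by rw [← hξ.norm_two]; exact (hξ.window 2).2
  have hh0 := hξ.zero_one
  nlinarith

/-- `h ≤ a ≤ 3/2`. [cite: Tao2016AveragedNS, §3.2 (3.7) p. 15] -/
theorem zero_one_le : ξ 0 1 ≤ 3 / 2 := by
  have h := hξ.sq_add_sq
  have ha := (hξ.window 0).2
  nlinarith [sq_nonneg (ξ 0 0), norm_nonneg (ξ 0), hξ.zero_one]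

end IsFrameTriple

/-! ### Every closed base triangle in the window is a rotated frame triple -/

/-- The frame `(w, n × w, n)` of two orthogonal unit vectors is orthonormal. [folklore] -/
private theorem orthonormal_frame' {w n : ℝ³} (hw : ‖w‖ = 1) (hn : ‖n‖ = 1) (hnw : ⟪n, w⟫ = 0) :
    Orthonormal ℝ ![w, cross n w, n] := by
  classical
  have hv : ‖cross n w‖ = 1 := by
    have h := norm_cross_sq n w
    rw [hw, hn, hnw] at h
    nlinarith [norm_nonneg (cross n w)]
  have hwn : ⟪w, n⟫ = 0 := by rw [real_inner_comm]; exact hnw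
  rw [orthonormal_iff_ite]
  intro i j
  fin_cases i <;> fin_cases j <;>
    simp [hw, hn, hv, hnw, hwn, inner_self_cross_left, inner_self_cross_right, real_inner_comm]

/-- **Every closed base triple with sides in `[4/5, 3/2]` is a rotated frame triple**: there are a
linear isometry `S` of `ℝ³` and a frame triple `ζ` with `ξ j = S (ζ j)` for all `j` (take the
orthonormal frame `(ξ 2/|ξ 2|, n × ξ 2/|ξ 2|, n)`, `n = (ξ 0 × ξ 1)/|ξ 0 × ξ 1|`; the coordinates of
`ξ j` in it form `ζ`). Tao §3.2: "we have the freedom to rotate … each of the `ξⱼ⁰` as we please";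
without dilations the side lengths stay. [cite: Tao2016AveragedNS, §3.2 (3.7) p. 15 and Remark 3.5 p. 20] -/
theorem exists_isometry_frameTriple (ξ : Fin 3 → ℝ³) (hsum : ξ 0 + ξ 1 + ξ 2 = 0)
    (hwin : ∀ j, 4 / 5 ≤ ‖ξ j‖ ∧ ‖ξ j‖ ≤ 3 / 2) :
    ∃ (S : ℝ³ ≃ₗᵢ[ℝ] ℝ³) (ζ : Fin 3 → ℝ³), IsFrameTriple ζ ∧ ∀ j, ξ j = S (ζ j) := by
  classical
  have hne : ∀ j, ξ j ≠ 0 := by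
    intro j h; have := (hwin j).1; rw [h, norm_zero] at this; linarith
  have hwin' : ∀ j, 79 / 100 ≤ ‖ξ j‖ ∧ ‖ξ j‖ ≤ 151 / 100 := fun j =>
    ⟨by linarith [(hwin j).1], by linarith [(hwin j).2]⟩
  have hcr_ge := norm_cross_ge_of_window ξ hsum hwin'
  have hcr : cross (ξ 0) (ξ 1) ≠ 0 := by
    intro h; rw [h, norm_zero] at hcr_ge; linarith
  -- the frame
  set w : ℝ³ := udir (ξ 2) with hw
  set n : ℝ³ := gammaNormal ξ with hn
  have hw1 : ‖w‖ = 1 := norm_udir (hne 2)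
  have hn1 : ‖n‖ = 1 := norm_gammaNormal hcr
  have hnξ : ∀ j, ⟪n, ξ j⟫ = 0 := inner_gammaNormal hsum
  have hnw : ⟪n, w⟫ = 0 := by
    rw [hw, udir, real_inner_smul_right, hnξ 2, mul_zero]
  have hon := orthonormal_frame' hw1 hn1 hnw
  have hcard : finrank ℝ ℝ³ = Fintype.card (Fin 3) := finrank_euclideanSpace
  set v : Fin 3 → ℝ³ := ![w, cross n w, n] with hv
  have hsp : ⊤ ≤ Submodule.span ℝ (Set.range v) :=
    (hon.linearIndependent.span_eq_top_of_card_eq_finrank' hcard.symm).ge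
  set b : OrthonormalBasis (Fin 3) ℝ ℝ³ := OrthonormalBasis.mk hon hsp with hbdef
  have hb0 : b 0 = w := by rw [hbdef, OrthonormalBasis.coe_mk]; rfl
  have hb1 : b 1 = cross n w := by rw [hbdef, OrthonormalBasis.coe_mk]; rfl
  have hb2 : b 2 = n := by rw [hbdef, OrthonormalBasis.coe_mk]; rfl
  -- the coordinates
  set ζ : Fin 3 → ℝ³ := fun j => b.repr (ξ j) with hζ
  have hcoord : ∀ j i, ζ j i = ⟪b i, ξ j⟫ := fun j i => by
    rw [hζ]; exact b.repr_apply_apply (ξ j) i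
  have hξ2w : ⟪w, ξ 2⟫ = ‖ξ 2‖ := inner_udir_self _
  have hvξ2 : ⟪cross n w, ξ 2⟫ = 0 := by
    rw [eq_norm_smul_udir (hne 2), ← hw, real_inner_smul_right, inner_cross_self_right, mul_zero]
  have hvξ0 : ⟪cross n w, ξ 0⟫ = ‖cross (ξ 0) (ξ 1)‖ / ‖ξ 2‖ := by
    have h2 : ξ 2 = -ξ 0 - ξ 1 := by rw [eq_neg_of_add_eq_zero_right hsum]; abel
    have hc02 : cross (ξ 0) (ξ 2) = -cross (ξ 0) (ξ 1) := by
      rw [h2]; ext i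
      fin_cases i <;> simp [cross_apply_zero, cross_apply_one, cross_apply_two] <;> ring
    have hkey : ⟪cross n (ξ 2), ξ 0⟫ = ‖cross (ξ 0) (ξ 1)‖ := by
      rw [inner_cross_left_eq_neg, hc02, inner_neg_right, neg_neg, hn, gammaNormal, inner_udir_self]
    rw [hw, udir, cross_smul_right, real_inner_smul_left, hkey, div_eq_inv_mul]
  refine ⟨b.repr.symm, ζ, ⟨?_, ?_, ?_, ?_, ?_, ?_⟩, fun j => ?_⟩
  · -- closes
    show b.repr (ξ 0) + b.repr (ξ 1) + b.repr (ξ 2) = 0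
    rw [← map_add, ← map_add, hsum, map_zero]
  · intro j; rw [hcoord j 2, hb2, hnξ j]
  · rw [hcoord 2 1, hb1, hvξ2]
  · rw [hcoord 2 0, hb0, hξ2w]; exact norm_pos_iff.mpr (hne 2)
  · rw [hcoord 0 1, hb1, hvξ0]
    exact div_pos (lt_of_lt_of_le (by norm_num) hcr_ge) (norm_pos_iff.mpr (hne 2))
  · intro j
    have : ‖ζ j‖ = ‖ξ j‖ := by rw [hζ]; exact b.repr.norm_map (ξ j)
    rw [this]; exact hwin j
  · show ξ j = b.repr.symm (b.repr (ξ j))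
    rw [LinearIsometryEquiv.symm_apply_apply]

/-! ### The non-degeneracy (3.24) near a base triangle with distinct input moduli -/

/-- **Non-degeneracy within radius `δ` of a base triple `ξ`**: for every CLOSED triangle `η` with
`|ηⱼ - ξⱼ| < δ` the `ηⱼ` are non-zero and non-collinear, `n(η) = (η₀ × η₁)/|η₀ × η₁|`
(`gammaNormal`) is a unit normal of the `ηⱼ`, and the frame values `λ_σ(η, n(η))` (`= 8 c_σ`, the
Fourier coefficients of (3.24)) are non-zero for all eight sign patterns — the body of the tree's
`lambdaSigma_ne_zero_near_xi0` (there: at `xi0`, for SOME `δ > 0`) with the base triple and the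
radius as parameters (Tao's `Γ ⊆ Πⱼ B(ξⱼ⁰, Cε₀³)`, (3.18)). A `Prop`-valued definition.
[cite: Tao2016AveragedNS, §3.7 (3.18) p. 19 and §3.9 (3.24) p. 20] -/
def NondegWithin (ξ : Fin 3 → ℝ³) (δ : ℝ) : Prop :=
  ∀ η : Fin 3 → ℝ³, (∀ j, ‖η j - ξ j‖ < δ) → η 0 + η 1 + η 2 = 0 →
    (∀ j, η j ≠ 0) ∧ cross (η 0) (η 1) ≠ 0 ∧ ‖gammaNormal η‖ = 1 ∧
      (∀ j, ⟪gammaNormal η, η j⟫ = 0) ∧ ∀ σ, lambdaSigma η (gammaNormal η) σ ≠ 0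

/-- `NondegWithin` is monotone in the radius. [cite: Tao2016AveragedNS, §3.7 (3.18) p. 19] -/
theorem NondegWithin.mono {ξ : Fin 3 → ℝ³} {δ δ' : ℝ} (h : NondegWithin ξ δ) (hle : δ' ≤ δ) :
    NondegWithin ξ δ' :=
  fun η hη hsum => h η (fun j => lt_of_lt_of_le (hη j) hle) hsum

/-- The triple product in `c_σ` along the canonical normal: `⟪(η₀/|η₀|) × n(η), η₁⟫ = -|η₀ × η₁|/|η₀|`. [folklore] -/
private theorem inner_cross_udir_gammaNormal {η : Fin 3 → ℝ³} (h0 : η 0 ≠ 0) (hcr : cross (η 0) (η 1) ≠ 0) :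
    ⟪cross (udir (η 0)) (gammaNormal η), η 1⟫ = -(‖cross (η 0) (η 1)‖ / ‖η 0‖) := by
  rw [real_inner_comm, gammaNormal]
  exact inner_cross_frame_eq h0 hcr

/-- **(3.24) near every base triangle with sides in `[4/5, 3/2]` and distinct input moduli, with a
radius linear in the input gap**: if `0 < δ ≤ 1/100` and `2δ < |‖ξ 0‖ - ‖ξ 1‖|`, then
`NondegWithin ξ δ`. For a closed `η` within `δ` of `ξ`: its sides lie in `[79/100, 151/100]`
(strict triangle inequalities, `|η₀ × η₁| ≥ 1/16`), the triple product along `n(η)` is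
`-|η₀ × η₁|/|η₀| ≠ 0`, and `‖η 0‖ ≠ ‖η 1‖`; so `c_σ(η, n(η)) ≠ 0` by `cSigma_ne_zero_of_triangle`
(Remark 3.5: (3.24) holds off the isosceles locus) and `λ_σ = 8 c_σ`. [cite: Tao2016AveragedNS, §3.9 (3.24) p. 20 and Remark 3.5 p. 20] -/
theorem nondegWithin_of_window_gap (ξ : Fin 3 → ℝ³)
    (hwin : ∀ j, 4 / 5 ≤ ‖ξ j‖ ∧ ‖ξ j‖ ≤ 3 / 2) {δ : ℝ} (hδ1 : δ ≤ 1 / 100)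
    (hgap : 2 * δ < |‖ξ 0‖ - ‖ξ 1‖|) : NondegWithin ξ δ := by
  intro η hη hsum
  -- the sides of `η`
  have hside : ∀ j, |‖η j‖ - ‖ξ j‖| < δ := fun j =>
    lt_of_le_of_lt (abs_norm_sub_norm_le _ _) (hη j)
  have hwin' : ∀ j, 79 / 100 ≤ ‖η j‖ ∧ ‖η j‖ ≤ 151 / 100 := by
    intro j
    obtain ⟨h1, h2⟩ := abs_lt.mp (hside j)
    obtain ⟨w1, w2⟩ := hwin j
    exact ⟨by linarith, by linarith⟩
  have hne : ∀ j, η j ≠ 0 := by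
    intro j h; have := (hwin' j).1; rw [h, norm_zero] at this; linarith
  have hcr_ge := norm_cross_ge_of_window η hsum hwin'
  have hcr : cross (η 0) (η 1) ≠ 0 := by
    intro h; rw [h, norm_zero] at hcr_ge; linarith
  have hn1 : ‖gammaNormal η‖ = 1 := norm_gammaNormal hcr
  have hn : ∀ j, ⟪gammaNormal η, η j⟫ = 0 := inner_gammaNormal hsum
  refine ⟨hne, hcr, hn1, hn, fun σ => ?_⟩
  rw [lambdaSigma_eq_cSigma hn1 hn]
  refine mul_ne_zero (by norm_num) ?_
  have hA : ⟪cross (udir (η 0)) (gammaNormal η), η 1⟫ ≠ 0 := by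
    rw [inner_cross_udir_gammaNormal (hne 0) hcr]
    have : 0 < ‖cross (η 0) (η 1)‖ / ‖η 0‖ := div_pos (by linarith) (norm_pos_iff.mpr (hne 0))
    linarith
  have htri : ‖η 2‖ < ‖η 0‖ + ‖η 1‖ ∧ ‖η 0‖ < ‖η 1‖ + ‖η 2‖ ∧ ‖η 1‖ < ‖η 0‖ + ‖η 2‖ := by
    obtain ⟨a1, a2⟩ := hwin' 0
    obtain ⟨b1, b2⟩ := hwin' 1
    obtain ⟨c1, c2⟩ := hwin' 2
    exact ⟨by linarith, by linarith, by linarith⟩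
  have hab : ‖η 0‖ ≠ ‖η 1‖ := by
    intro h
    obtain ⟨h0a, h0b⟩ := abs_lt.mp (hside 0)
    obtain ⟨h1a, h1b⟩ := abs_lt.mp (hside 1)
    have : |‖ξ 0‖ - ‖ξ 1‖| < 2 * δ := by
      rw [abs_lt]; constructor <;> linarith
    linarith
  exact cSigma_ne_zero_of_triangle η (gammaNormal η) hsum hA htri hab σ

/-- **The crux's radius.** For a base triple with sides in `[4/5, 3/2]` and input gap
`|‖ξ 0‖ - ‖ξ 1‖| ≥ κ ε₀` (`κ > 0`, `0 < ε₀`), (3.24) holds within radius `min (1/100) (κ ε₀ / 4)`.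
[cite: Tao2016AveragedNS, §3.9 (3.24) p. 20 and Remark 3.5 p. 20] -/
theorem nondegWithin_of_gap (ξ : Fin 3 → ℝ³) (hwin : ∀ j, 4 / 5 ≤ ‖ξ j‖ ∧ ‖ξ j‖ ≤ 3 / 2)
    {κ ε₀ : ℝ} (hκ : 0 < κ) (hε : 0 < ε₀) (hgap : κ * ε₀ ≤ |‖ξ 0‖ - ‖ξ 1‖|) :
    NondegWithin ξ (min (1 / 100) (κ * ε₀ / 4)) := by
  refine nondegWithin_of_window_gap ξ hwin (min_le_left _ _) ?_
  have : 0 < κ * ε₀ := mul_pos hκ hε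
  have h4 : 2 * min (1 / 100 : ℝ) (κ * ε₀ / 4) ≤ κ * ε₀ / 2 := by
    linarith [min_le_right (1 / 100 : ℝ) (κ * ε₀ / 4)]
  linarith

end Literature.Analysis.FluidPDE.Tao2016
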